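import Summits.QuantumFields.YangMills.Theorems.BalabanLadderROTSkewTorusDLR
import Summits.QuantumFields.YangMills.Theorems.BalabanLadderNTMarkovMirror
import HarnessLib

/-!
# The DLR equations of a skew torus for bounded MEASURABLE cylinder observables, and the one-cube DLR identity of a period cell
# (kit for support `CellCubeDLR`, route `RecentredCoverTransfer`, stmt-QuantumFields-23165, LINE g9-D of planner ym-idea-1 g9)

Helper file (`--supports stmt-QuantumFields-23165 --as helper`; width seat `ym-line-sfw-p2-w3` g28 of cell ym-idea-1, free hands).
Definition-free, 0 sorry.

* §1 `integral_lift_eq_integral_kernel_lift_of_measurable` — the tree's DLR equations for Wilson's measure on ANY period cell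
  (`Theorems.ROT.PeriodCell.integral_lift_eq_integral_kernel_lift`, fleet `ym-spine-20042-p1`: `∫ F(Ũ) dμ_C = ∫ (γ_Λ F)(Ũ) dμ_C` for a
  finite edge set `Λ` with `red` injective on the base points of `Λ ∪ supp F ∪ ∂Λ`) with the hypothesis `Continuous F` replaced by
  `Measurable F`.  As for the straight torus (`Cruxes.UVSeamRec.DLRPeeling.wilsonExpectation_toTorusObservable_eq_of_measurable`), the
  tree's proof uses continuity of `F` only to produce (strong) measurability; the proof is transcribed verbatim with
  `measurable_glueWith_prod` in place of `continuous_glueWith_prod` (all lemmas are the tree's).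
* §2 ★ `integral_kerE_cellLift_eq` — the ONE-CUBE DLR identity of a period cell in the `DlrCollarTransfer` letters: for a cube `(c, b)`
  whose 2-thickened window injects modulo the period lattice and a bounded measurable cylinder `F` with links based in `[c, c + b]`,
  `∫ kerE_{(c,b)}(lift U)(F) dμ_C = ∫ F(lift U) dμ_C` (injectivity of `red` on the base points of `cubeEdges ∪ supp F ∪ ∂ cubeEdges`
  from the window: `cubeEdges_fst_window`, `exists_near_of_mem_plaquetteEdges_touching`, `red_eq_red_iff`).  The item `CellCubeDLR`
  is this statement by name (`Theorems/RecentredCoverTransferCellCubeDLR.lean`).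

HONEST FRAMING: folklore probability (Georgii 2011 (4.18); Friedli–Velenik 2017 (6.34), periodic b.c.) in the tree's vocabulary;
no crux, no rung (R2d ROT is a RECORD rung), no summit and no mass gap is proved by this.
-/

set_option autoImplicit false

noncomputable section

open scoped BigOperators ENNReal
open MeasureTheory Filter Topology Finset
open Literature.MathematicalPhysics.QuantumLattice
open Literature.MathematicalPhysics.QuantumFieldTheory (haarProbability LatticeRep)
open Literature.Probability.LatticeModels (Site glueWith glueWith_apply_mem glueWith_apply_not_mem measurable_glueWith)
open Summit.QuantumFields.YangMills.Theorems.ROT (PeriodCell)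

namespace Summit.QuantumFields.YangMills.Theorems.RecentredCoverTransfer

/-! ## §1 The DLR equations of a skew torus, measurable observable -/

section DLR

variable {d : ℕ} (C : PeriodCell d) {G : Type*} [Group G] {N : ℕ} (ρ : G →* Matrix (Fin N) (Fin N) ℂ)
  [TopologicalSpace G] [IsTopologicalGroup G] [CompactSpace G] [MeasurableSpace G] [BorelSpace G] [SecondCountableTopology G]

/-- **Wilson states of a skew torus satisfy the local DLR equations of `ymSpecification` — bounded MEASURABLE cylinder
observables.**  Let `F` be a bounded measurable cylinder observable on `ℤᵈ` with support `S₀`, `Λ` a finite edge set, and let the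
reduction `red` of the period cell be injective on the base points of `Λ ∪ S₀ ∪ ∂Λ`.  Then
`∫ F(Ũ) dμ_C(U) = ∫ (γ_Λ F)(Ũ) dμ_C(U)` (`Ũ = lift U`, `γ_Λ = ymSpecification ρ β Λ`).  The tree's proof for continuous `F`
(`PeriodCell.integral_lift_eq_integral_kernel_lift`) transcribed, with measurability supplied by `Measurable F`.
[cite: Georgii2011, Thm. 4.17 (4.18)] -/
theorem integral_lift_eq_integral_kernel_lift_of_measurable (hρ : Continuous ρ) (β : ℝ) (Λ : Finset (ZdEdge d))
    {F : LGConfig d G → ℝ} (hF : Measurable F) {B : ℝ} (hB : ∀ U, |F U| ≤ B)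
    {S₀ : Finset (ZdEdge d)} (hFS : IsCylinder F S₀)
    (hred : Set.InjOn C.red ((Λ ∪ S₀ ∪ (plaquettesTouching Λ).biUnion plaquetteEdges).image Prod.fst : Set (Site d))) :
    ∫ U, F (C.lift U) ∂(C.measure (G := G) ρ β) =
      ∫ U, (∫ W, F W ∂(ymSpecification ρ β Λ (C.lift U))) ∂(C.measure (G := G) ρ β) := by
  classical
  -- the relevant finite edge set `T` and the injectivity consequences of `hred`
  have hΛT : Λ ⊆ Λ ∪ S₀ ∪ (plaquettesTouching Λ).biUnion plaquetteEdges :=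
    (subset_union_left).trans subset_union_left
  have hS₀T : S₀ ⊆ Λ ∪ S₀ ∪ (plaquettesTouching Λ).biUnion plaquetteEdges :=
    (subset_union_right).trans subset_union_left
  have hPT : (plaquettesTouching Λ).biUnion plaquetteEdges ⊆
      Λ ∪ S₀ ∪ (plaquettesTouching Λ).biUnion plaquetteEdges := subset_union_right
  have hTinj := C.injOn_cellEdge hred
  have hPinj := C.injOn_cellPlaq (image_subset_image hPT) hred
  -- near and far parts of the skew-torus action
  set a : C.Config G → ℝ := fun V =>
    -β * ∑ q ∈ (plaquettesTouching Λ).image (fun p : ZdPlaquette d => ((C.toRep p.1, p.2) : C.TPlaq)),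
      ((N : ℝ) - (ρ (C.holonomy V q.1 q.2.1.1 q.2.1.2)).trace.re)
    with ha_def
  set b : C.Config G → ℝ := fun V =>
    -β * ∑ q ∈ ((plaquettesTouching Λ).image (fun p : ZdPlaquette d => ((C.toRep p.1, p.2) : C.TPlaq)))ᶜ,
      ((N : ℝ) - (ρ (C.holonomy V q.1 q.2.1.1 q.2.1.2)).trace.re)
    with hb_def
  have hab : ∀ V, -β * C.action ρ V = a V + b V := fun V => by
    simp only [ha_def, hb_def, PeriodCell.action, ← mul_add, Finset.sum_add_sum_compl]
  have ha : ∀ V, a V = -β * wilsonBoundaryAction ρ Λ (C.lift V) := fun V => by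
    simp only [ha_def, C.sum_image_cellPlaq_term ρ hPinj]
  have hb : ∀ W V, b ((Λ.image (fun e : ZdEdge d => ((C.toRep e.1, e.2) : C.TEdge))).piecewise W V) = b V :=
      fun W V => by
    simp only [hb_def]
    congr 1
    refine Finset.sum_congr rfl fun q hq => ?_
    rw [C.holonomy_piecewise_of_ne (fun p hp h => (Finset.mem_compl.1 hq) (Finset.mem_image.2 ⟨p, hp, h⟩)) W V]
  have hac : Continuous a :=
    continuous_const.mul (continuous_finsetSum _ fun q _ => C.continuous_holonomyTerm ρ hρ q)
  have hbc : Continuous b :=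
    continuous_const.mul (continuous_finsetSum _ fun q _ => C.continuous_holonomyTerm ρ hρ q)
  obtain ⟨A, hA⟩ := exists_bound_of_continuous hac
  obtain ⟨B', hB'⟩ := exists_bound_of_continuous hbc
  have hFt : Measurable fun V : C.Config G => F (C.lift V) := hF.comp C.continuous_lift.measurable
  -- transfer of the fibre integrals from `G^Λ` to the skew torus
  have hτ : Function.Injective fun e : ↥Λ => ((C.toRep (e : ZdEdge d).1, (e : ZdEdge d).2) : C.TEdge) :=
    fun e₁ e₂ h => Subtype.ext (hTinj (hΛT e₁.2) (hΛT e₂.2) h)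
  have transfer : ∀ Φ : LGConfig d G → ℝ, Measurable Φ →
      DependsOn Φ ↑(Λ ∪ S₀ ∪ (plaquettesTouching Λ).biUnion plaquetteEdges) →
      ∀ V : C.Config G,
        ∫ ζ, Φ (glueWith Λ ζ (C.lift V)) ∂(Measure.pi fun _ : ↥Λ => haarProbability G) =
          ∫ W, Φ (C.lift ((Λ.image (fun e : ZdEdge d => ((C.toRep e.1, e.2) : C.TEdge))).piecewise W V))
            ∂(Measure.pi fun _ : C.TEdge => haarProbability G) := by
    intro Φ hΦm hΦT V
    have hm : Measurable fun (W : C.Config G) (e : ↥Λ) => W (C.toRep (e : ZdEdge d).1, (e : ZdEdge d).2) :=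
      measurable_pi_iff.2 fun e => measurable_pi_apply _
    have hc : Measurable fun ζ : ↥Λ → G => Φ (glueWith Λ ζ (C.lift V)) :=
      hΦm.comp ((measurable_glueWith_prod Λ).comp (measurable_const.prodMk measurable_id))
    rw [← pi_map_comp_injective (haarProbability G) hτ, integral_map hm.aemeasurable hc.aestronglyMeasurable]
    refine congrArg _ (funext fun W => hΦT fun e he => ?_)
    exact (C.lift_piecewise_apply hΛT hTinj W V he).symm
  -- locality of the two fibre integrands
  have hST : DependsOn (wilsonBoundaryAction (G := G) ρ Λ) ↑(Λ ∪ S₀ ∪ (plaquettesTouching Λ).biUnion plaquetteEdges) :=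
    (isCylinder_wilsonBoundaryAction_holds (G := G) ρ Λ).mono (Finset.coe_subset.2 hPT)
  have hFT : DependsOn F ↑(Λ ∪ S₀ ∪ (plaquettesTouching Λ).biUnion plaquetteEdges) :=
    hFS.mono (Finset.coe_subset.2 hS₀T)
  have hw : Continuous fun U : LGConfig d G => Real.exp (-β * wilsonBoundaryAction ρ Λ U) :=
    Real.continuous_exp.comp (continuous_const.mul (continuous_wilsonBoundaryAction ρ hρ Λ))
  -- the kernel average of `F` at a periodic boundary condition, computed on the skew torus
  have key : ∀ V : C.Config G,
      ∫ U, F U ∂(ymSpecification ρ β Λ (C.lift V)) =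
        (∫ W, F (C.lift ((Λ.image (fun e : ZdEdge d => ((C.toRep e.1, e.2) : C.TEdge))).piecewise W V)) *
              Real.exp (a ((Λ.image (fun e : ZdEdge d => ((C.toRep e.1, e.2) : C.TEdge))).piecewise W V))
            ∂(Measure.pi fun _ : C.TEdge => haarProbability G)) /
          ∫ W, Real.exp (a ((Λ.image (fun e : ZdEdge d => ((C.toRep e.1, e.2) : C.TEdge))).piecewise W V))
            ∂(Measure.pi fun _ : C.TEdge => haarProbability G) := by
    intro V
    rw [integral_ymSpecification ρ hρ β Λ hF,
      transfer (fun U => F U * Real.exp (-β * wilsonBoundaryAction ρ Λ U)) (hF.mul hw.measurable)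
        (fun x y h => by simp only [hFT h, hST h]),
      transfer (fun U => Real.exp (-β * wilsonBoundaryAction ρ Λ U)) hw.measurable (fun x y h => by simp only [hST h])]
    simp only [ha]
  -- conclude with the finite-volume DLR identity on the skew torus
  rw [C.integral_measure_eq_toReal_mul_integral ρ hρ β, C.integral_measure_eq_toReal_mul_integral ρ hρ β]
  congr 1
  simp only [key, hab]
  exact integral_exp_mul_eq_integral_exp_mul_condAvg (haarProbability G)
    (Λ.image (fun e : ZdEdge d => ((C.toRep e.1, e.2) : C.TEdge)))
    (F := fun V => F (C.lift V))
    (NF := fun V => ∫ W, F (C.lift ((Λ.image (fun e : ZdEdge d => ((C.toRep e.1, e.2) : C.TEdge))).piecewise W V)) *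
      Real.exp (a ((Λ.image (fun e : ZdEdge d => ((C.toRep e.1, e.2) : C.TEdge))).piecewise W V))
        ∂(Measure.pi fun _ : C.TEdge => haarProbability G))
    (N1 := fun V => ∫ W, Real.exp (a ((Λ.image (fun e : ZdEdge d => ((C.toRep e.1, e.2) : C.TEdge))).piecewise W V))
      ∂(Measure.pi fun _ : C.TEdge => haarProbability G))
    hFt hac.measurable hbc.measurable (fun V => hB _) hA hB' hb (fun V => rfl) (fun V => rfl)

end DLR

/-! ## §2 ★ The one-cube DLR identity of a period cell -/

section Cube

open Summit.QuantumFields.YangMills.Cruxes.OSLegsFromFemtoAndGap.DlrCollarTransfer (kerE cubeEdges)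
open Summit.QuantumFields.YangMills.Cruxes.NT.MarkovMirror (cubeEdges_fst_window)
open Summit.QuantumFields.YangMills.Theorems.OSLegsFromFemtoAndGap.StubLower (exists_near_of_mem_plaquetteEdges_touching)

variable {G : Type} [Group G] [TopologicalSpace G] [IsTopologicalGroup G] [CompactSpace G]
  [MeasurableSpace G] [BorelSpace G]

/-- Base points of `cubeEdges (c, b) ∪ S_F ∪ ∂ cubeEdges (c, b)` lie in the 2-thickened window of the cube when the links of `S_F` are
based in `[c, c + b]` (the Wilson interaction has range one). [folklore] -/
theorem window_of_mem_image_fst (c : Fin 4 → ℤ) (b : ℕ) {SF : Finset (ZdEdge 4)}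
    (hSF : ∀ e ∈ SF, ∀ j, c j ≤ e.1 j ∧ e.1 j ≤ c j + b) {z : Site 4}
    (hz : z ∈ ((cubeEdges c b ∪ SF ∪ (plaquettesTouching (cubeEdges c b)).biUnion plaquetteEdges).image Prod.fst : Set (Site 4)))
    (j : Fin 4) : c j - 2 ≤ z j ∧ z j ≤ c j + b + 2 := by
  obtain ⟨e, he, rfl⟩ := Finset.mem_image.1 (Finset.mem_coe.1 hz)
  rcases Finset.mem_union.1 he with he' | he'
  · rcases Finset.mem_union.1 he' with h1 | h2
    · have h := cubeEdges_fst_window h1 j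
      constructor <;> linarith [h.1, h.2]
    · have h := hSF e h2 j
      constructor <;> linarith [h.1, h.2]
  · obtain ⟨e', he'Λ, hnear⟩ := exists_near_of_mem_plaquetteEdges_touching he'
    have h := cubeEdges_fst_window he'Λ j
    have h' := hnear j
    constructor <;> linarith [h.1, h.2, h'.1, h'.2]

/-- ★ **The one-cube DLR identity of a period cell.**  If the 2-thickened window of the cube `(c, b)` injects modulo the period
lattice `P`, then for every bounded measurable cylinder observable `F` with links based in `[c, c + b]`:
`∫ kerE_{(c,b)}(lift U)(F) dμ_C(U) = ∫ F(lift U) dμ_C(U)`. [cite: Georgii2011, Thm. 4.17 (4.18)] -/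
theorem integral_kerE_cellLift_eq (r : LatticeRep G) (Ce : PeriodCell 4) (β : ℝ) (c : Fin 4 → ℤ) (b : ℕ)
    (hinj : ∀ z w : Fin 4 → ℤ, (∀ j, c j - 2 ≤ z j ∧ z j ≤ c j + b + 2) → (∀ j, c j - 2 ≤ w j ∧ w j ≤ c j + b + 2) →
      z - w ∈ Ce.P → z = w)
    (F : LGConfig 4 G → ℝ) (hF : Measurable F) {M : ℝ} (hM : ∀ U, |F U| ≤ M)
    (SF : Finset (ZdEdge 4)) (hFS : IsCylinder F SF) (hSF : ∀ e ∈ SF, ∀ j, c j ≤ e.1 j ∧ e.1 j ≤ c j + b) :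
    ∫ U, kerE G r β c b (Ce.lift U) F ∂(Ce.measure r.ρ β) = ∫ U, F (Ce.lift U) ∂(Ce.measure r.ρ β) := by
  haveI := r.secondCountableTopology
  have hred : Set.InjOn Ce.red
      ((cubeEdges c b ∪ SF ∪ (plaquettesTouching (cubeEdges c b)).biUnion plaquetteEdges).image Prod.fst : Set (Site 4)) :=
    fun z hz w hw h => hinj z w (window_of_mem_image_fst c b hSF hz) (window_of_mem_image_fst c b hSF hw)
      ((Ce.red_eq_red_iff z w).1 h)
  unfold kerE
  exact (integral_lift_eq_integral_kernel_lift_of_measurable Ce r.ρ r.continuous β (cubeEdges c b) hF hM hFS hred).symm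

end Cube

end Summit.QuantumFields.YangMills.Theorems.RecentredCoverTransfer

end
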